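/-
Copyright (c) 2026 the pub-hodgecm-mathlib formalisation cell (harness21).  Prover seat hodgecm-mathlib-K2Liu-p09 (g5): Track B «K2-LIT»,
hLiu418 = stmt-HodgeConjecture-24832; LEAD F0P6-plan RULINGS M-156m∕o, M-157a (4)∕c «A7 = GK COCYCLE ROAD», file B7-B.
-/
import Summits.HodgeConjecture.HodgeConjecture.Theorems.K2LiuSiegelCocycleStepShort              -- ★ B4d-2 (p09): the short-root words (+ B4c-2∕3, B1b-2a)
import Summits.HodgeConjecture.HodgeConjecture.Theorems.K2LiuSiegelCocycleLetters                -- ★ B4d-1b `norm_eq_coe_normAbs`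
import Literature.NumberTheory.Automorphic.TateLocalZetaShells                                   -- ★ `integral_comp_mul_left` (`dμ(a y) = |a|⁻¹ dμ(y)`)
import HarnessLib

/-!
# Crux `HLiu418`, road `K2_Liu`, organ A7-reg (GK cocycle road), file B7-B:
# THE SHORT-ROOT RANK-ONE OPERATOR AT A PLACE `w ∣ v`: `(ℬ_w F)(g) = ∫_{E_w} F(φ(P_w) φ(u₋(1_w ζ)) g) dζ` — relation, invariances, torus law

Cell `hodgecm-mathlib`, crux item hLiu418 = `stmt-HodgeConjecture-24832`; squad K2 ∕ K2Liu; prover K2Liu-p09 (g5).  THEOREMS ONLY (no `def`, no instance,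
no notation, no named-fact hypothesis, no `sorry`); lane `--supports stmt-HodgeConjecture-24832` (count-neutral helper).  ONE FRAME (RULING M-156o (c)):
`φ := frameConj Q ∘ toLocalFour` (★ B1b-1, K2Liu-p03 (g6)).
THE POINT.  The middle operator `A₁` of `M_v(s) = A₂ A₁ A₂` lives on the Siegel Levi `GL₂(E ⊗ F_v) = ∏_{w∣v} GL₂(E_w)`; at the place `w` its letters are
the partial Weyl element `P_w = m(1−ε_w, ε_w; ε_w, 1−ε_w)`, `ε_w = 1_w := Pi.single w 1` (★ B4c-2), and the root letter `u₋(1_w ζ)`, `ζ ∈ E_w`.  For a GENERAL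
`F : H_v → ℂ` with (N)∕(T) (★ B4d-1b for Siegel sections, ★ B7-A for `𝒜F`), and an additive Haar measure `μ_w` on `E_w`:
* §0 the idempotent `1_w` and the units of `E ⊗ F_v` supported at `w` (`ms_w(y)`, `y ∈ E_wˣ`): the `(ε, t, a, b)` data of ★ B4d-2.
* §1 **the short-root relation in `E_w`-coordinates**: `F(φ(P_w) φ(u₋(1_w x)) g) = θ (ms_w(−x⁻¹)) (ms_w(x)) · F(φ(P_w) φ(u₋(1_w x⁻¹)) φ(P_w) g)` (★ B4d-2
  `apply_partialWeyl_uMinus`) — the `hrel` binder of ★ `K2LiuRankOneOperators.integrable_and_integral_eq` up to the evaluation of `θ` (sequel B7-V).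
* §2 (N) is inherited: `ℬ_w F(φ(ℓ) g) = ℬ_w F(g)` for `ℓ = n(X)` (needs (N) for all `n(X)`), `u₋(1_w b)` (Haar translation), `u₋(1_{w′} b)`, `w′ ≠ w` (needs `u₋`);
  and `u₋(r) = ∏_{w′} u₋(1_{w′} r_{w′})`, so invariance under every `u₋(1_{w′} ·)` is invariance under every `u₋(r)`.
* §3 (T) transforms: **`ℬ_w F(φ(t(a,b)) g) = θ a′ b′ · ‖a_w‖ ‖b_w‖⁻¹ · ℬ_w F(g)`**, `a′ = a·ms_w(a_w)⁻¹·ms_w(b_w)`, `b′ = b·ms_w(b_w)⁻¹·ms_w(a_w)` (the `w`-components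
  swapped; ★ B4d-2 torus word + the substitution `ζ ↦ b_w a_w⁻¹ ζ`, ★ `integral_comp_mul_left`).
HONEST LABEL.  `HC_CM` is proved only modulo the 7 printed citations (2 remaining named inputs: hLiu418 = `stmt-HodgeConjecture-24832`,
h413 = `stmt-HodgeConjecture-24833`) until rung 0 closes.

## References
* [Casselman1980] W. Casselman, *The unramified principal series of p-adic groups I*, Compositio Math. 40 (1980), §3 (rank-one operators, Thm. 3.1).
* [HarrisKudlaSweet1996] M. Harris, S. Kudla, W. J. Sweet, J. AMS 9 (1996), §1 (1.11)–(1.15), §6 (6.16).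
* [Tate1950] J. Tate, *Fourier analysis in number fields and Hecke's zeta-functions* (1950), §2.2.
-/

set_option autoImplicit false
set_option linter.dupNamespace false -- the mandated namespace repeats `HodgeConjecture.HodgeConjecture`

noncomputable section

open scoped Classical NNReal
open NumberField IsDedekindDomain Matrix MeasureTheory
open Literature.NumberTheory.GaloisRepresentations.IsNonarchimedeanLocalField
open Literature.NumberTheory.Automorphic Literature.NumberTheory.Automorphic.UnitaryGroup
open Literature.NumberTheory.GelbartRogawski1991.AdaptedBlocks
open Literature.NumberTheory.GelbartRogawski1991.UnitaryDualPair.LocalSplitting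
open Summit.HodgeConjecture.HodgeConjecture.Cruxes.HLiu418.K2LiuLocalSiegelIwasawaFrame
open Summit.HodgeConjecture.HodgeConjecture.Cruxes.HLiu418.K2LiuLocalSiegelIwasawa
open Summit.HodgeConjecture.HodgeConjecture.Cruxes.HLiu418.K2LiuDoubledUTwoTwoBorelFrame
open Summit.HodgeConjecture.HodgeConjecture.Cruxes.HLiu418.K2LiuDoubledUTwoTwoWeylCocycle
open Summit.HodgeConjecture.HodgeConjecture.Cruxes.HLiu418.K2LiuDoubledUTwoTwoLevi
open Summit.HodgeConjecture.HodgeConjecture.Cruxes.HLiu418.K2LiuDoubledUTwoTwoFrameTransport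
open Summit.HodgeConjecture.HodgeConjecture.Cruxes.HLiu418.K2LiuSiegelCocycleStepShort
open Summit.HodgeConjecture.HodgeConjecture.Cruxes.HLiu418.K2LiuSiegelCocycleLetters

namespace Summit.HodgeConjecture.HodgeConjecture.Cruxes.HLiu418.K2LiuSiegelCocycleStageShort

variable (F : Type) [Field F] [NumberField F] (E : Type) [Field E] [NumberField E] [Algebra F E]
  [Algebra.IsQuadraticExtension F E] (c : E ≃ₐ[F] E)
  {δ : E} (hcδ : c δ = -δ) (hδ : δ ≠ 0) (v : HeightOneSpectrum (𝓞 F))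
  {T₂ : Matrix (Fin 2) (Fin 2) F} {J₂D : Matrix (Fin (2 + 2)) (Fin (2 + 2)) E} (hJ₂D : J₂D = (gramD F 2 T₂).map (algebraMap F E))
  (Q : GL (Fin (2 + 2)) F)
  (hQ : (Q : Matrix (Fin (2 + 2)) (Fin (2 + 2)) F)ᵀ * gramD F 2 T₂ * (Q : Matrix (Fin (2 + 2)) (Fin (2 + 2)) F) = (StdForm.antidiagonal (2 + 2)).over F)
  (w : PlacesOver E v)

/-! ## §0 The idempotent `1_w` and the units supported at `w` -/

section Units

omit [NumberField F] [Algebra.IsQuadraticExtension F E] in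
/-- `1_w` is idempotent. [cite: HarrisKudlaSweet1996, §6 (6.16)] -/
theorem single_one_mul_single_one :
    (Pi.single w (1 : w.1.adicCompletion E) : UnitaryGroup.LocalRing E v) * Pi.single w (1 : w.1.adicCompletion E) = Pi.single w 1 := by
  rw [← Pi.single_mul, mul_one]

omit [NumberField F] [Algebra.IsQuadraticExtension F E] in
/-- `1_w · 1_w(ζ) = 1_w(ζ)` (the letter `u₋(1_w ζ)` in the `ε · t` format of ★ B4d-2). [cite: HarrisKudlaSweet1996, §6 (6.16)] -/
theorem single_one_mul_single (ζ : w.1.adicCompletion E) :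
    (Pi.single w (1 : w.1.adicCompletion E) : UnitaryGroup.LocalRing E v) * Pi.single w ζ = Pi.single w ζ := by
  rw [← Pi.single_mul, one_mul]

omit [NumberField F] [Algebra.IsQuadraticExtension F E] in
/-- `1_w 1_{w′} = 0` for `w ≠ w′`. [cite: HarrisKudlaSweet1996, §6 (6.16)] -/
theorem single_one_mul_single_one_of_ne {w' : PlacesOver E v} (h : w ≠ w') :
    (Pi.single w (1 : w.1.adicCompletion E) : UnitaryGroup.LocalRing E v) * Pi.single w' (1 : w'.1.adicCompletion E) = 0 := by
  ext w''
  rw [Pi.mul_apply, Pi.zero_apply]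
  by_cases h1 : w'' = w
  · subst h1; rw [Pi.single_eq_of_ne h, mul_zero]
  · rw [Pi.single_eq_of_ne h1, zero_mul]

omit [NumberField F] [Algebra.IsQuadraticExtension F E] in
/-- `r · 1_w(ζ) = 1_w(r_w ζ)`. [cite: HarrisKudlaSweet1996, §6 (6.16)] -/
theorem mul_single (r : UnitaryGroup.LocalRing E v) (ζ : w.1.adicCompletion E) :
    r * Pi.single w ζ = Pi.single w (r w * ζ) := by
  ext w''
  rw [Pi.mul_apply]
  by_cases h1 : w'' = w
  · subst h1; rw [Pi.single_eq_same, Pi.single_eq_same]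
  · rw [Pi.single_eq_of_ne h1, Pi.single_eq_of_ne h1, mul_zero]

omit [NumberField F] [Algebra.IsQuadraticExtension F E] in
/-- the value of the unit `ms_w(y)` supported at `w`. [cite: HarrisKudlaSweet1996, §6 (6.16)] -/
theorem val_placeUnit (y : (w.1.adicCompletion E)ˣ) :
    ((Units.map (MonoidHom.mulSingle (fun w' : PlacesOver E v => w'.1.adicCompletion E) w) y : (UnitaryGroup.LocalRing E v)ˣ) : UnitaryGroup.LocalRing E v) =
      Pi.mulSingle w (y : w.1.adicCompletion E) := rfl

omit [NumberField F] [Algebra.IsQuadraticExtension F E] in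
/-- `ms_w(x) = 1 − 1_w + 1_w · ms_w(x)` — the `b`-unit of ★ B4d-2 `apply_partialWeyl_uMinus` at `t = ms_w(x)`. [cite: Casselman1980, §3] -/
theorem val_placeUnit_eq (x : (w.1.adicCompletion E)ˣ) :
    ((Units.map (MonoidHom.mulSingle (fun w' : PlacesOver E v => w'.1.adicCompletion E) w) x : (UnitaryGroup.LocalRing E v)ˣ) : UnitaryGroup.LocalRing E v) =
      1 - Pi.single w 1 + Pi.single w 1 *
        ((Units.map (MonoidHom.mulSingle (fun w' : PlacesOver E v => w'.1.adicCompletion E) w) x : (UnitaryGroup.LocalRing E v)ˣ) : UnitaryGroup.LocalRing E v) := by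
  rw [val_placeUnit]
  ext w''
  simp only [Pi.add_apply, Pi.sub_apply, Pi.mul_apply, Pi.one_apply]
  by_cases h1 : w'' = w
  · subst h1; simp
  · simp [h1]

omit [NumberField F] [Algebra.IsQuadraticExtension F E] in
/-- `ms_w(−x⁻¹) = 1 − 1_w − 1_w · ms_w(x)⁻¹` — the `a`-unit of ★ B4d-2 `apply_partialWeyl_uMinus` at `t = ms_w(x)`. [cite: Casselman1980, §3] -/
theorem val_placeUnit_neg_inv_eq (x : (w.1.adicCompletion E)ˣ) :
    ((Units.map (MonoidHom.mulSingle (fun w' : PlacesOver E v => w'.1.adicCompletion E) w) (-x⁻¹) : (UnitaryGroup.LocalRing E v)ˣ) : UnitaryGroup.LocalRing E v) =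
      1 - Pi.single w 1 - Pi.single w 1 *
        (((Units.map (MonoidHom.mulSingle (fun w' : PlacesOver E v => w'.1.adicCompletion E) w) x)⁻¹ : (UnitaryGroup.LocalRing E v)ˣ) : UnitaryGroup.LocalRing E v) := by
  rw [← map_inv, val_placeUnit, val_placeUnit]
  ext w''
  simp only [Pi.sub_apply, Pi.mul_apply, Pi.one_apply]
  by_cases h1 : w'' = w
  · subst h1; simp
  · simp [h1]

omit [NumberField F] [Algebra.IsQuadraticExtension F E] in
/-- `1_w · ms_w(y) = 1_w(y)`. [cite: HarrisKudlaSweet1996, §6 (6.16)] -/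
theorem single_one_mul_placeUnit (y : (w.1.adicCompletion E)ˣ) :
    (Pi.single w (1 : w.1.adicCompletion E) : UnitaryGroup.LocalRing E v) *
        ((Units.map (MonoidHom.mulSingle (fun w' : PlacesOver E v => w'.1.adicCompletion E) w) y : (UnitaryGroup.LocalRing E v)ˣ) : UnitaryGroup.LocalRing E v) =
      Pi.single w (y : w.1.adicCompletion E) := by
  rw [val_placeUnit]
  ext w''
  rw [Pi.mul_apply]
  by_cases h1 : w'' = w
  · subst h1; simp
  · simp [h1]

omit [NumberField F] [Algebra.IsQuadraticExtension F E] in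
/-- **the swapped units**: `a · ms_w(a_w)⁻¹ · ms_w(b_w) = (1 − 1_w) a + 1_w b` (the `a′`∕`b′` of ★ B4d-2 `apply_partialWeyl_uMinus_mul_torusElt`).
[cite: Casselman1980, §3] -/
theorem val_swapUnit (a b : (UnitaryGroup.LocalRing E v)ˣ) :
    ((a * (Units.map (MonoidHom.mulSingle (fun w' : PlacesOver E v => w'.1.adicCompletion E) w)
          (Units.map (Pi.evalMonoidHom (fun w' : PlacesOver E v => w'.1.adicCompletion E) w) a))⁻¹ *
        Units.map (MonoidHom.mulSingle (fun w' : PlacesOver E v => w'.1.adicCompletion E) w)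
          (Units.map (Pi.evalMonoidHom (fun w' : PlacesOver E v => w'.1.adicCompletion E) w) b) : (UnitaryGroup.LocalRing E v)ˣ) : UnitaryGroup.LocalRing E v) =
      (1 - Pi.single w 1) * (a : UnitaryGroup.LocalRing E v) + Pi.single w 1 * (b : UnitaryGroup.LocalRing E v) := by
  rw [Units.val_mul, Units.val_mul, ← map_inv, val_placeUnit, val_placeUnit]
  ext w''
  simp only [Pi.mul_apply, Pi.add_apply, Pi.sub_apply, Pi.one_apply]
  by_cases h1 : w'' = w
  · subst h1
    simp only [Pi.mulSingle_eq_same, Pi.single_eq_same, Units.coe_map_inv, Pi.evalMonoidHom_apply, Units.coe_map, sub_self, zero_mul, zero_add, one_mul]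
    rw [← Pi.mul_apply, Units.mul_inv, Pi.one_apply, one_mul]
  · simp [h1]

end Units

/-! ## §1 The short-root relation in `E_w`-coordinates -/

section Relation

variable (F' : UnitaryGroup.localPi E c (2 + 2) J₂D v → ℂ) (θ : (UnitaryGroup.LocalRing E v)ˣ → (UnitaryGroup.LocalRing E v)ˣ → ℂ)
  (A : GL (Fin 2) (UnitaryGroup.LocalRing E v)) (hA : A.val = !![1 - Pi.single w 1, Pi.single w 1; Pi.single w 1, 1 - Pi.single w 1])

include hcδ hδ hA in
/-- **THE SHORT-ROOT RELATION IN `E_w`-COORDINATES.**  For `F : H_v → ℂ` with (N) for the Levi root letters `φ(u₋(r))` and torus law `θ`, and `x ∈ E_wˣ`: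
`F(φ(P_w) · φ(u₋(1_w x)) · g) = θ (ms_w(−x⁻¹)) (ms_w(x)) · F(φ(P_w) · φ(u₋(1_w x⁻¹)) · φ(P_w) · g)` — ★ B4d-2 `apply_partialWeyl_uMinus` at `ε = 1_w`,
`t = ms_w(x)`. [cite: Casselman1980, §3] [cite: HarrisKudlaSweet1996, §6 (6.16)] -/
theorem apply_partialWeyl_uMinus_coord
    (hM : ∀ (r : UnitaryGroup.LocalRing E v) (g : UnitaryGroup.localPi E c (2 + 2) J₂D v), F' (FrameTransport.frameConj F E c v (2 + 2) hJ₂D (antidiagonal_over_eq_map F E 2) Q hQ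
          (toLocalFour F E c v (uMinus (UnitaryGroup.LocalRing E v) (UnitaryGroup.conjLocal E c v) (UnitaryGroup.conjLocal_conjLocal c v hcδ hδ) r)) * g) = F' g)
    (hT : ∀ (a b : (UnitaryGroup.LocalRing E v)ˣ) (g : UnitaryGroup.localPi E c (2 + 2) J₂D v), F' (FrameTransport.frameConj F E c v (2 + 2) hJ₂D (antidiagonal_over_eq_map F E 2) Q hQ
          (toLocalFour F E c v (torusElt (UnitaryGroup.LocalRing E v) (UnitaryGroup.conjLocal E c v) (UnitaryGroup.conjLocal_conjLocal c v hcδ hδ) a b)) * g) = θ a b * F' g)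
    (x : (w.1.adicCompletion E)ˣ) (g : UnitaryGroup.localPi E c (2 + 2) J₂D v) :
    F' (FrameTransport.frameConj F E c v (2 + 2) hJ₂D (antidiagonal_over_eq_map F E 2) Q hQ
          (toLocalFour F E c v (leviElt (UnitaryGroup.LocalRing E v) (UnitaryGroup.conjLocal E c v) (UnitaryGroup.conjLocal_conjLocal c v hcδ hδ) A)) *
        FrameTransport.frameConj F E c v (2 + 2) hJ₂D (antidiagonal_over_eq_map F E 2) Q hQ
          (toLocalFour F E c v (uMinus (UnitaryGroup.LocalRing E v) (UnitaryGroup.conjLocal E c v) (UnitaryGroup.conjLocal_conjLocal c v hcδ hδ) (Pi.single w (x : w.1.adicCompletion E)))) * g) =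
      θ (Units.map (MonoidHom.mulSingle (fun w' : PlacesOver E v => w'.1.adicCompletion E) w) (-x⁻¹))
          (Units.map (MonoidHom.mulSingle (fun w' : PlacesOver E v => w'.1.adicCompletion E) w) x) *
        F' (FrameTransport.frameConj F E c v (2 + 2) hJ₂D (antidiagonal_over_eq_map F E 2) Q hQ
              (toLocalFour F E c v (leviElt (UnitaryGroup.LocalRing E v) (UnitaryGroup.conjLocal E c v) (UnitaryGroup.conjLocal_conjLocal c v hcδ hδ) A)) *
            FrameTransport.frameConj F E c v (2 + 2) hJ₂D (antidiagonal_over_eq_map F E 2) Q hQ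
              (toLocalFour F E c v (uMinus (UnitaryGroup.LocalRing E v) (UnitaryGroup.conjLocal E c v) (UnitaryGroup.conjLocal_conjLocal c v hcδ hδ)
                (Pi.single w ((x⁻¹ : (w.1.adicCompletion E)ˣ) : w.1.adicCompletion E)))) *
            FrameTransport.frameConj F E c v (2 + 2) hJ₂D (antidiagonal_over_eq_map F E 2) Q hQ
              (toLocalFour F E c v (leviElt (UnitaryGroup.LocalRing E v) (UnitaryGroup.conjLocal E c v) (UnitaryGroup.conjLocal_conjLocal c v hcδ hδ) A)) * g) := by
  have h := apply_partialWeyl_uMinus F E c hcδ hδ v hJ₂D Q hQ F' θ hM hT (single_one_mul_single_one F E v w)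
    (Units.map (MonoidHom.mulSingle (fun w' : PlacesOver E v => w'.1.adicCompletion E) w) x) A hA _ _
    (val_placeUnit_neg_inv_eq F E v w x) (val_placeUnit_eq F E v w x) g
  rw [single_one_mul_placeUnit, ← map_inv, single_one_mul_placeUnit] at h
  simp only [map_mul] at h
  exact h

end Relation

/-! ## §2 (N) is inherited by `ℬ_w F` -/

section Invariance

variable [MeasurableSpace (w.1.adicCompletion E)] [BorelSpace (w.1.adicCompletion E)] (μw : Measure (w.1.adicCompletion E))
  (F' : UnitaryGroup.localPi E c (2 + 2) J₂D v → ℂ) (A : GL (Fin 2) (UnitaryGroup.LocalRing E v))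

omit [BorelSpace (w.1.adicCompletion E)] in
include hcδ hδ in
/-- **`ℬ_w F(φ(n(X)) g) = ℬ_w F(g)`** for `F` invariant under every block letter (★ B4d-2 `apply_leviElt_uMinus_mul_nSiegelBlk`, integrated).
[cite: HarrisKudlaSweet1996, §1 (1.11)] -/
theorem stageShort_apply_nSiegelBlk
    (hN : ∀ (X : Matrix (Fin 2) (Fin 2) (UnitaryGroup.LocalRing E v)) (hX : IsSkewTwo (UnitaryGroup.LocalRing E v) (UnitaryGroup.conjLocal E c v) X) (g : UnitaryGroup.localPi E c (2 + 2) J₂D v),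
      F' (FrameTransport.frameConj F E c v (2 + 2) hJ₂D (antidiagonal_over_eq_map F E 2) Q hQ (toLocalFour F E c v (nSiegelBlk (UnitaryGroup.LocalRing E v) (UnitaryGroup.conjLocal E c v) hX)) * g) = F' g)
    (X : Matrix (Fin 2) (Fin 2) (UnitaryGroup.LocalRing E v)) (hX : IsSkewTwo (UnitaryGroup.LocalRing E v) (UnitaryGroup.conjLocal E c v) X)
    (g : UnitaryGroup.localPi E c (2 + 2) J₂D v) :
    ∫ ζ, F' (FrameTransport.frameConj F E c v (2 + 2) hJ₂D (antidiagonal_over_eq_map F E 2) Q hQ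
          (toLocalFour F E c v (leviElt (UnitaryGroup.LocalRing E v) (UnitaryGroup.conjLocal E c v) (UnitaryGroup.conjLocal_conjLocal c v hcδ hδ) A)) *
        FrameTransport.frameConj F E c v (2 + 2) hJ₂D (antidiagonal_over_eq_map F E 2) Q hQ
          (toLocalFour F E c v (uMinus (UnitaryGroup.LocalRing E v) (UnitaryGroup.conjLocal E c v) (UnitaryGroup.conjLocal_conjLocal c v hcδ hδ) (Pi.single w ζ))) *
        (FrameTransport.frameConj F E c v (2 + 2) hJ₂D (antidiagonal_over_eq_map F E 2) Q hQ (toLocalFour F E c v (nSiegelBlk (UnitaryGroup.LocalRing E v) (UnitaryGroup.conjLocal E c v) hX)) * g)) ∂μw =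
      ∫ ζ, F' (FrameTransport.frameConj F E c v (2 + 2) hJ₂D (antidiagonal_over_eq_map F E 2) Q hQ
          (toLocalFour F E c v (leviElt (UnitaryGroup.LocalRing E v) (UnitaryGroup.conjLocal E c v) (UnitaryGroup.conjLocal_conjLocal c v hcδ hδ) A)) *
        FrameTransport.frameConj F E c v (2 + 2) hJ₂D (antidiagonal_over_eq_map F E 2) Q hQ
          (toLocalFour F E c v (uMinus (UnitaryGroup.LocalRing E v) (UnitaryGroup.conjLocal E c v) (UnitaryGroup.conjLocal_conjLocal c v hcδ hδ) (Pi.single w ζ))) * g) ∂μw :=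
  integral_congr_ae (Filter.Eventually.of_forall fun ζ => apply_leviElt_uMinus_mul_nSiegelBlk F E c hcδ hδ v hJ₂D Q hQ F' hN A (Pi.single w ζ) X hX g)

include hcδ hδ in
/-- **`ℬ_w F(φ(u₋(1_w b)) g) = ℬ_w F(g)`** for ANY `F`: translate `ζ ↦ ζ + b` (★ `uMinus_mul`, `μ_w` translation invariant). [cite: Casselman1980, §3] -/
theorem stageShort_apply_uMinus_single [μw.IsAddRightInvariant] (b : w.1.adicCompletion E) (g : UnitaryGroup.localPi E c (2 + 2) J₂D v) :
    ∫ ζ, F' (FrameTransport.frameConj F E c v (2 + 2) hJ₂D (antidiagonal_over_eq_map F E 2) Q hQ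
          (toLocalFour F E c v (leviElt (UnitaryGroup.LocalRing E v) (UnitaryGroup.conjLocal E c v) (UnitaryGroup.conjLocal_conjLocal c v hcδ hδ) A)) *
        FrameTransport.frameConj F E c v (2 + 2) hJ₂D (antidiagonal_over_eq_map F E 2) Q hQ
          (toLocalFour F E c v (uMinus (UnitaryGroup.LocalRing E v) (UnitaryGroup.conjLocal E c v) (UnitaryGroup.conjLocal_conjLocal c v hcδ hδ) (Pi.single w ζ))) *
        (FrameTransport.frameConj F E c v (2 + 2) hJ₂D (antidiagonal_over_eq_map F E 2) Q hQ
          (toLocalFour F E c v (uMinus (UnitaryGroup.LocalRing E v) (UnitaryGroup.conjLocal E c v) (UnitaryGroup.conjLocal_conjLocal c v hcδ hδ) (Pi.single w b))) * g)) ∂μw =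
      ∫ ζ, F' (FrameTransport.frameConj F E c v (2 + 2) hJ₂D (antidiagonal_over_eq_map F E 2) Q hQ
          (toLocalFour F E c v (leviElt (UnitaryGroup.LocalRing E v) (UnitaryGroup.conjLocal E c v) (UnitaryGroup.conjLocal_conjLocal c v hcδ hδ) A)) *
        FrameTransport.frameConj F E c v (2 + 2) hJ₂D (antidiagonal_over_eq_map F E 2) Q hQ
          (toLocalFour F E c v (uMinus (UnitaryGroup.LocalRing E v) (UnitaryGroup.conjLocal E c v) (UnitaryGroup.conjLocal_conjLocal c v hcδ hδ) (Pi.single w ζ))) * g) ∂μw := by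
  have h : ∀ ζ : w.1.adicCompletion E,
      FrameTransport.frameConj F E c v (2 + 2) hJ₂D (antidiagonal_over_eq_map F E 2) Q hQ
          (toLocalFour F E c v (leviElt (UnitaryGroup.LocalRing E v) (UnitaryGroup.conjLocal E c v) (UnitaryGroup.conjLocal_conjLocal c v hcδ hδ) A)) *
        FrameTransport.frameConj F E c v (2 + 2) hJ₂D (antidiagonal_over_eq_map F E 2) Q hQ
          (toLocalFour F E c v (uMinus (UnitaryGroup.LocalRing E v) (UnitaryGroup.conjLocal E c v) (UnitaryGroup.conjLocal_conjLocal c v hcδ hδ) (Pi.single w ζ))) *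
        (FrameTransport.frameConj F E c v (2 + 2) hJ₂D (antidiagonal_over_eq_map F E 2) Q hQ
          (toLocalFour F E c v (uMinus (UnitaryGroup.LocalRing E v) (UnitaryGroup.conjLocal E c v) (UnitaryGroup.conjLocal_conjLocal c v hcδ hδ) (Pi.single w b))) * g) =
      FrameTransport.frameConj F E c v (2 + 2) hJ₂D (antidiagonal_over_eq_map F E 2) Q hQ
          (toLocalFour F E c v (leviElt (UnitaryGroup.LocalRing E v) (UnitaryGroup.conjLocal E c v) (UnitaryGroup.conjLocal_conjLocal c v hcδ hδ) A)) *
        FrameTransport.frameConj F E c v (2 + 2) hJ₂D (antidiagonal_over_eq_map F E 2) Q hQ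
          (toLocalFour F E c v (uMinus (UnitaryGroup.LocalRing E v) (UnitaryGroup.conjLocal E c v) (UnitaryGroup.conjLocal_conjLocal c v hcδ hδ) (Pi.single w (ζ + b)))) * g := by
    intro ζ
    rw [mul_assoc, ← mul_assoc _ _ g, ← map_mul, ← map_mul, uMinus_mul, Pi.single_add, ← mul_assoc]
  simp_rw [h]
  exact integral_add_right_eq_self (μ := μw) (fun ζ => F' (FrameTransport.frameConj F E c v (2 + 2) hJ₂D (antidiagonal_over_eq_map F E 2) Q hQ
          (toLocalFour F E c v (leviElt (UnitaryGroup.LocalRing E v) (UnitaryGroup.conjLocal E c v) (UnitaryGroup.conjLocal_conjLocal c v hcδ hδ) A)) *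
        FrameTransport.frameConj F E c v (2 + 2) hJ₂D (antidiagonal_over_eq_map F E 2) Q hQ
          (toLocalFour F E c v (uMinus (UnitaryGroup.LocalRing E v) (UnitaryGroup.conjLocal E c v) (UnitaryGroup.conjLocal_conjLocal c v hcδ hδ) (Pi.single w ζ))) * g)) b

omit [BorelSpace (w.1.adicCompletion E)] in
include hcδ hδ in
/-- **`ℬ_w F(φ(u₋(1_{w′} b)) g) = ℬ_w F(g)`** for `w′ ≠ w` and `F` invariant under the Levi root letters (★ B4d-2 `apply_partialWeyl_uMinus_mul_uMinus_other` with
`1_w 1_{w′} = 0`). [cite: HarrisKudlaSweet1996, §6 (6.16)] -/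
theorem stageShort_apply_uMinus_single_of_ne (hA : A.val = !![1 - Pi.single w 1, Pi.single w 1; Pi.single w 1, 1 - Pi.single w 1])
    (hM : ∀ (r : UnitaryGroup.LocalRing E v) (g : UnitaryGroup.localPi E c (2 + 2) J₂D v), F' (FrameTransport.frameConj F E c v (2 + 2) hJ₂D (antidiagonal_over_eq_map F E 2) Q hQ
          (toLocalFour F E c v (uMinus (UnitaryGroup.LocalRing E v) (UnitaryGroup.conjLocal E c v) (UnitaryGroup.conjLocal_conjLocal c v hcδ hδ) r)) * g) = F' g)
    {w' : PlacesOver E v} (hw' : w ≠ w') (b : w'.1.adicCompletion E) (g : UnitaryGroup.localPi E c (2 + 2) J₂D v) :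
    ∫ ζ, F' (FrameTransport.frameConj F E c v (2 + 2) hJ₂D (antidiagonal_over_eq_map F E 2) Q hQ
          (toLocalFour F E c v (leviElt (UnitaryGroup.LocalRing E v) (UnitaryGroup.conjLocal E c v) (UnitaryGroup.conjLocal_conjLocal c v hcδ hδ) A)) *
        FrameTransport.frameConj F E c v (2 + 2) hJ₂D (antidiagonal_over_eq_map F E 2) Q hQ
          (toLocalFour F E c v (uMinus (UnitaryGroup.LocalRing E v) (UnitaryGroup.conjLocal E c v) (UnitaryGroup.conjLocal_conjLocal c v hcδ hδ) (Pi.single w ζ))) *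
        (FrameTransport.frameConj F E c v (2 + 2) hJ₂D (antidiagonal_over_eq_map F E 2) Q hQ
          (toLocalFour F E c v (uMinus (UnitaryGroup.LocalRing E v) (UnitaryGroup.conjLocal E c v) (UnitaryGroup.conjLocal_conjLocal c v hcδ hδ) (Pi.single w' b))) * g)) ∂μw =
      ∫ ζ, F' (FrameTransport.frameConj F E c v (2 + 2) hJ₂D (antidiagonal_over_eq_map F E 2) Q hQ
          (toLocalFour F E c v (leviElt (UnitaryGroup.LocalRing E v) (UnitaryGroup.conjLocal E c v) (UnitaryGroup.conjLocal_conjLocal c v hcδ hδ) A)) *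
        FrameTransport.frameConj F E c v (2 + 2) hJ₂D (antidiagonal_over_eq_map F E 2) Q hQ
          (toLocalFour F E c v (uMinus (UnitaryGroup.LocalRing E v) (UnitaryGroup.conjLocal E c v) (UnitaryGroup.conjLocal_conjLocal c v hcδ hδ) (Pi.single w ζ))) * g) ∂μw := by
  refine integral_congr_ae (Filter.Eventually.of_forall fun ζ => ?_)
  have h := apply_partialWeyl_uMinus_mul_uMinus_other F E c hcδ hδ v hJ₂D Q hQ F' hM (single_one_mul_single_one_of_ne F E v w hw') A hA
    (Pi.single w ζ) (Pi.single w' b) g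
  rwa [single_one_mul_single, single_one_mul_single] at h

include hcδ hδ in
/-- **invariance under every `u₋(1_{w′} b)` is invariance under every `u₋(r)`** (`r = ∑_{w′} 1_{w′} r_{w′}`, ★ `uMinus_mul`). For the function `g ↦ T g`
this is pure algebra (`T` = `ℬ_w F` in the application). [cite: HarrisKudlaSweet1996, §1 (1.11)] -/
theorem apply_uMinus_of_forall_single (T : UnitaryGroup.localPi E c (2 + 2) J₂D v → ℂ)
    (h : ∀ (w' : PlacesOver E v) (b : w'.1.adicCompletion E) (g : UnitaryGroup.localPi E c (2 + 2) J₂D v),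
      T (FrameTransport.frameConj F E c v (2 + 2) hJ₂D (antidiagonal_over_eq_map F E 2) Q hQ
        (toLocalFour F E c v (uMinus (UnitaryGroup.LocalRing E v) (UnitaryGroup.conjLocal E c v) (UnitaryGroup.conjLocal_conjLocal c v hcδ hδ) (Pi.single w' b))) * g) = T g)
    (r : UnitaryGroup.LocalRing E v) (g : UnitaryGroup.localPi E c (2 + 2) J₂D v) :
    T (FrameTransport.frameConj F E c v (2 + 2) hJ₂D (antidiagonal_over_eq_map F E 2) Q hQ
      (toLocalFour F E c v (uMinus (UnitaryGroup.LocalRing E v) (UnitaryGroup.conjLocal E c v) (UnitaryGroup.conjLocal_conjLocal c v hcδ hδ) r)) * g) = T g := by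
  have key : ∀ (s : Finset (PlacesOver E v)) (g : UnitaryGroup.localPi E c (2 + 2) J₂D v),
      T (FrameTransport.frameConj F E c v (2 + 2) hJ₂D (antidiagonal_over_eq_map F E 2) Q hQ
        (toLocalFour F E c v (uMinus (UnitaryGroup.LocalRing E v) (UnitaryGroup.conjLocal E c v) (UnitaryGroup.conjLocal_conjLocal c v hcδ hδ)
          (∑ w' ∈ s, Pi.single w' (r w')))) * g) = T g := by
    intro s
    induction s using Finset.induction_on with
    | empty => intro g; rw [Finset.sum_empty, uMinus_zero, map_one, map_one, one_mul]
    | insert a s ha ih =>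
      intro g
      rw [Finset.sum_insert ha, ← uMinus_mul, map_mul, map_mul, mul_assoc, h, ih]
  have hr : r = ∑ w' ∈ Finset.univ, Pi.single w' (r w') := (Finset.univ_sum_single r).symm
  rw [hr]
  exact key _ g

end Invariance

/-! ## §3 The torus law of `ℬ_w F` -/

section Torus

variable [MeasurableSpace (w.1.adicCompletion E)] [BorelSpace (w.1.adicCompletion E)] (μw : Measure (w.1.adicCompletion E)) [μw.IsAddHaarMeasure]
  (F' : UnitaryGroup.localPi E c (2 + 2) J₂D v → ℂ) (θ : (UnitaryGroup.LocalRing E v)ˣ → (UnitaryGroup.LocalRing E v)ˣ → ℂ)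
  (A : GL (Fin 2) (UnitaryGroup.LocalRing E v)) (hA : A.val = !![1 - Pi.single w 1, Pi.single w 1; Pi.single w 1, 1 - Pi.single w 1])

include hcδ hδ hA in
/-- **THE TORUS LAW OF `ℬ_w F`**: `ℬ_w F(φ(t(a,b)) g) = θ a′ b′ · ‖a_w‖ ‖b_w‖⁻¹ · ℬ_w F(g)` with the `w`-swapped units `a′ = a ms_w(a_w)⁻¹ ms_w(b_w)`,
`b′ = b ms_w(b_w)⁻¹ ms_w(a_w)` (★ B4d-2 torus word: the root variable becomes `b_w a_w⁻¹ ζ`; `dμ_w(λζ) = ‖λ‖ dμ_w(ζ)`, ★ `integral_comp_mul_left`).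
[cite: Casselman1980, §3] [cite: Tate1950, §2.2] -/
theorem stageShort_apply_torusElt
    (hT : ∀ (a b : (UnitaryGroup.LocalRing E v)ˣ) (g : UnitaryGroup.localPi E c (2 + 2) J₂D v), F' (FrameTransport.frameConj F E c v (2 + 2) hJ₂D (antidiagonal_over_eq_map F E 2) Q hQ
          (toLocalFour F E c v (torusElt (UnitaryGroup.LocalRing E v) (UnitaryGroup.conjLocal E c v) (UnitaryGroup.conjLocal_conjLocal c v hcδ hδ) a b)) * g) = θ a b * F' g)
    (a b : (UnitaryGroup.LocalRing E v)ˣ) (g : UnitaryGroup.localPi E c (2 + 2) J₂D v) :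
    ∫ ζ, F' (FrameTransport.frameConj F E c v (2 + 2) hJ₂D (antidiagonal_over_eq_map F E 2) Q hQ
          (toLocalFour F E c v (leviElt (UnitaryGroup.LocalRing E v) (UnitaryGroup.conjLocal E c v) (UnitaryGroup.conjLocal_conjLocal c v hcδ hδ) A)) *
        FrameTransport.frameConj F E c v (2 + 2) hJ₂D (antidiagonal_over_eq_map F E 2) Q hQ
          (toLocalFour F E c v (uMinus (UnitaryGroup.LocalRing E v) (UnitaryGroup.conjLocal E c v) (UnitaryGroup.conjLocal_conjLocal c v hcδ hδ) (Pi.single w ζ))) *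
        (FrameTransport.frameConj F E c v (2 + 2) hJ₂D (antidiagonal_over_eq_map F E 2) Q hQ
          (toLocalFour F E c v (torusElt (UnitaryGroup.LocalRing E v) (UnitaryGroup.conjLocal E c v) (UnitaryGroup.conjLocal_conjLocal c v hcδ hδ) a b)) * g)) ∂μw =
      θ (a * (Units.map (MonoidHom.mulSingle (fun w' : PlacesOver E v => w'.1.adicCompletion E) w)
              (Units.map (Pi.evalMonoidHom (fun w' : PlacesOver E v => w'.1.adicCompletion E) w) a))⁻¹ *
            Units.map (MonoidHom.mulSingle (fun w' : PlacesOver E v => w'.1.adicCompletion E) w)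
              (Units.map (Pi.evalMonoidHom (fun w' : PlacesOver E v => w'.1.adicCompletion E) w) b))
          (b * (Units.map (MonoidHom.mulSingle (fun w' : PlacesOver E v => w'.1.adicCompletion E) w)
              (Units.map (Pi.evalMonoidHom (fun w' : PlacesOver E v => w'.1.adicCompletion E) w) b))⁻¹ *
            Units.map (MonoidHom.mulSingle (fun w' : PlacesOver E v => w'.1.adicCompletion E) w)
              (Units.map (Pi.evalMonoidHom (fun w' : PlacesOver E v => w'.1.adicCompletion E) w) a)) *
        ((‖(a : UnitaryGroup.LocalRing E v) w‖ * ‖(b : UnitaryGroup.LocalRing E v) w‖⁻¹ : ℝ) : ℂ) *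
      ∫ ζ, F' (FrameTransport.frameConj F E c v (2 + 2) hJ₂D (antidiagonal_over_eq_map F E 2) Q hQ
          (toLocalFour F E c v (leviElt (UnitaryGroup.LocalRing E v) (UnitaryGroup.conjLocal E c v) (UnitaryGroup.conjLocal_conjLocal c v hcδ hδ) A)) *
        FrameTransport.frameConj F E c v (2 + 2) hJ₂D (antidiagonal_over_eq_map F E 2) Q hQ
          (toLocalFour F E c v (uMinus (UnitaryGroup.LocalRing E v) (UnitaryGroup.conjLocal E c v) (UnitaryGroup.conjLocal_conjLocal c v hcδ hδ) (Pi.single w ζ))) * g) ∂μw := by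
  -- the scaling factor `λ = b_w a_w⁻¹ ≠ 0`
  set lam : w.1.adicCompletion E := (b : UnitaryGroup.LocalRing E v) w * ((a⁻¹ : (UnitaryGroup.LocalRing E v)ˣ) : UnitaryGroup.LocalRing E v) w with hlam
  have ha0 : (a : UnitaryGroup.LocalRing E v) w ≠ 0 := (Units.map (Pi.evalMonoidHom (fun w' : PlacesOver E v => w'.1.adicCompletion E) w) a).ne_zero
  have hb0 : (b : UnitaryGroup.LocalRing E v) w ≠ 0 := (Units.map (Pi.evalMonoidHom (fun w' : PlacesOver E v => w'.1.adicCompletion E) w) b).ne_zero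
  have hainv : ((a⁻¹ : (UnitaryGroup.LocalRing E v)ˣ) : UnitaryGroup.LocalRing E v) w = ((a : UnitaryGroup.LocalRing E v) w)⁻¹ :=
    eq_inv_of_mul_eq_one_right (by rw [← Pi.mul_apply, Units.mul_inv, Pi.one_apply])
  have hlam0 : lam ≠ 0 := mul_ne_zero hb0 (by rw [hainv]; exact inv_ne_zero ha0)
  -- integrand-wise: the torus word, the root variable becomes `λ ζ`
  have h : ∀ ζ : w.1.adicCompletion E,
      F' (FrameTransport.frameConj F E c v (2 + 2) hJ₂D (antidiagonal_over_eq_map F E 2) Q hQ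
          (toLocalFour F E c v (leviElt (UnitaryGroup.LocalRing E v) (UnitaryGroup.conjLocal E c v) (UnitaryGroup.conjLocal_conjLocal c v hcδ hδ) A)) *
        FrameTransport.frameConj F E c v (2 + 2) hJ₂D (antidiagonal_over_eq_map F E 2) Q hQ
          (toLocalFour F E c v (uMinus (UnitaryGroup.LocalRing E v) (UnitaryGroup.conjLocal E c v) (UnitaryGroup.conjLocal_conjLocal c v hcδ hδ) (Pi.single w ζ))) *
        (FrameTransport.frameConj F E c v (2 + 2) hJ₂D (antidiagonal_over_eq_map F E 2) Q hQ
          (toLocalFour F E c v (torusElt (UnitaryGroup.LocalRing E v) (UnitaryGroup.conjLocal E c v) (UnitaryGroup.conjLocal_conjLocal c v hcδ hδ) a b)) * g)) =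
      θ (a * (Units.map (MonoidHom.mulSingle (fun w' : PlacesOver E v => w'.1.adicCompletion E) w)
              (Units.map (Pi.evalMonoidHom (fun w' : PlacesOver E v => w'.1.adicCompletion E) w) a))⁻¹ *
            Units.map (MonoidHom.mulSingle (fun w' : PlacesOver E v => w'.1.adicCompletion E) w)
              (Units.map (Pi.evalMonoidHom (fun w' : PlacesOver E v => w'.1.adicCompletion E) w) b))
          (b * (Units.map (MonoidHom.mulSingle (fun w' : PlacesOver E v => w'.1.adicCompletion E) w)
              (Units.map (Pi.evalMonoidHom (fun w' : PlacesOver E v => w'.1.adicCompletion E) w) b))⁻¹ *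
            Units.map (MonoidHom.mulSingle (fun w' : PlacesOver E v => w'.1.adicCompletion E) w)
              (Units.map (Pi.evalMonoidHom (fun w' : PlacesOver E v => w'.1.adicCompletion E) w) a)) *
        F' (FrameTransport.frameConj F E c v (2 + 2) hJ₂D (antidiagonal_over_eq_map F E 2) Q hQ
            (toLocalFour F E c v (leviElt (UnitaryGroup.LocalRing E v) (UnitaryGroup.conjLocal E c v) (UnitaryGroup.conjLocal_conjLocal c v hcδ hδ) A)) *
          FrameTransport.frameConj F E c v (2 + 2) hJ₂D (antidiagonal_over_eq_map F E 2) Q hQ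
            (toLocalFour F E c v (uMinus (UnitaryGroup.LocalRing E v) (UnitaryGroup.conjLocal E c v) (UnitaryGroup.conjLocal_conjLocal c v hcδ hδ) (Pi.single w (lam * ζ)))) * g) := by
    intro ζ
    rw [apply_partialWeyl_uMinus_mul_torusElt F E c hcδ hδ v hJ₂D Q hQ F' θ hT (single_one_mul_single_one F E v w) A hA (Pi.single w ζ) a b _ _
      (val_swapUnit F E v w a b) (val_swapUnit F E v w b a) g, mul_single, hlam, Pi.mul_apply]
  simp_rw [h]
  rw [integral_const_mul]
  have hsub := Literature.NumberTheory.Automorphic.integral_comp_mul_left μw hlam0 fun ζ => F' (FrameTransport.frameConj F E c v (2 + 2) hJ₂D (antidiagonal_over_eq_map F E 2) Q hQ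
            (toLocalFour F E c v (leviElt (UnitaryGroup.LocalRing E v) (UnitaryGroup.conjLocal E c v) (UnitaryGroup.conjLocal_conjLocal c v hcδ hδ) A)) *
          FrameTransport.frameConj F E c v (2 + 2) hJ₂D (antidiagonal_over_eq_map F E 2) Q hQ
            (toLocalFour F E c v (uMinus (UnitaryGroup.LocalRing E v) (UnitaryGroup.conjLocal E c v) (UnitaryGroup.conjLocal_conjLocal c v hcδ hδ) (Pi.single w ζ))) * g)
  rw [hsub, Complex.real_smul, ← norm_eq_coe_normAbs E w.1, norm_inv, hlam, norm_mul, hainv, norm_inv, mul_inv, inv_inv,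
    mul_comm ‖((b : UnitaryGroup.LocalRing E v) w)‖⁻¹]
  simp only [mul_assoc]

end Torus

end Summit.HodgeConjecture.HodgeConjecture.Cruxes.HLiu418.K2LiuSiegelCocycleStageShort

end
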